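import Literature.IUT.LogThetaLattice.GlobalPacketsLGP
import Literature.IUT.LogThetaLattice.TensorPackets
import Mathlib.RingTheory.PiTensorProduct
import HarnessLib

/-!
# [IUTchIII] Proposition 3.1 (i)/(ii), 3.4 (i): the Galois action on the tensor packets — `^AΠ_{v_ℚ}` acting
# factorwise on `log(^A𝓕_{v_ℚ})`, `^αΠ_v` acting on `log(^{A,α}𝓕_v)`, the EQUIVARIANCE of `log(^α𝓕_v) → log(^{A,α}𝓕_v)`,
# and the Galois invariants of the single packet monoids

S. Mochizuki, *Inter-universal Teichmüller theory III*, kurims manuscript (May 2020) `paper:url-4b091feeb646`, §3: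
Proposition 3.1 (i) p. 93 ("Such decompositions [as direct sums of fields] are compatible … with the natural
action of the topological group `^αΠ_v` [on the direct summand with subscript `v` of the factor labeled `α`]"),
(ii) p. 93 ("a natural injective homomorphism of ind-topological rings `log(^α𝓕_v) → log(^{A,α}𝓕_v)` … in a fashion
that is compatible with the natural actions of `^αΠ_v`"), Proposition 3.4 (i) p. 102 ("the first displayed
monoid, together with its `^αΠ_v`-action"), (ii) p. 103 l. 5–7 / 14–16 ("the submonoid of Galois invariants [cf.
(i)] …"; "this Galois action is trivial when `v ∈ 𝕍^arc`") [claim: Mochizuki2012, status: disputed] for every quoted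
sentence; abc-iut cell, layer L6, seat abc-iut-L6-t4 (typer of record of [IUTchIII] §3; gen 4). Sub-DAG
`plan/L6/SUBDAG-IUTchIII-Prop-34.md` row **r5** ("the `Π_v`-action on `log(^{A,α}𝓕_v)` = ι-extension of the action
on `log(^α𝓕_v)` ⊗ actions on the other factors is not typed anywhere yet (merge debt … × L6-t4-successor)");
abc-iut-L6-t4's `TensorPackets.lean` docstrings leave "group actions" as TODO.

WHAT IS BUILT (Mathlib only; no interface, no instance, no `Prop` fact):
* §1 functoriality of the `n`-fold tensor product of ALGEBRAS in algebra (iso)morphisms — `piTensorMapAlgHom`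
  (from `PiTensorProduct.liftAlgHom`), `piTensorMapAlgEquiv`, and the group homomorphism
  `piTensorAut : (∏_i Aut_{𝕜-alg}(A_i)) →* Aut_{𝕜-alg}(⨂_i A_i)` (`_tprod` evaluation lemmas, `id`/`comp`);
* §2 **`packetNAut L`** = the natural action of `^AΠ_{v_ℚ} := ∏_{α ∈ A} ^αΠ_{v_ℚ}` on the `n`-tensor packet
  `log(^A𝓕_{v_ℚ}) = ⊗_α log(^α𝓕_{v_ℚ})` through the factorwise actions on the 1-packets (Prop. 3.1 (i)), and
  **`packetAtAut L α v`** = the action on `log(^{A,α}𝓕_v) = log(^α𝓕_v) ⊗ (⊗_{β≠α} log(^β𝓕_{v_ℚ}))` of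
  `^αΠ_v × ∏_{β≠α} ^βΠ_{v_ℚ}` — "the action on `log(^α𝓕_v)` ⊗ the actions on the other factors"
  (`Algebra.TensorProduct.congr`); **`packetAtAut_toPacketAt`**: Prop. 3.1 (ii)'s homomorphism
  `log(^α𝓕_v) → log(^{A,α}𝓕_v)` (abc-iut-L6-t4's `toPacketAt`) is EQUIVARIANT — PROVED;
* §3 `fixedSubalgebra S` (elements fixed by a set of algebra automorphisms) and, for Prop. 3.4 (i)/(ii):
  **`singlePacketMonoid_inf_fixed_eq`** — the Galois invariants, for `^αΠ_v` acting on the packet through the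
  `α`-factor, of the single packet monoid `ι(Ψ)` ARE the image `ι(Ψ^{^αΠ_v})` of the invariants (ι injective —
  Prop. 3.1 (ii) — and equivariant) — PROVED; this is the junction with p422157's `galFixed` (invariants taken at the
  source) — `map_fixed_le` in general, equality under injectivity.

HONEST SCOPE: topologies ("topological group", "ind-topological") are not modelled; the groups are abstract and act
by `𝕜`-algebra automorphisms (`𝕜 = ℚ_{v_ℚ}`); which automorphisms are "the natural action" is the input (any group
homomorphism into the automorphism groups). Nothing here asserts abc proved or refuted or takes a side on
[IUTchIII] Cor. 3.12; typed ≠ discharged.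
-/

noncomputable section

namespace Literature.IUT.LogThetaLattice

open scoped TensorProduct
open PiTensorProduct

universe u uι v v' w w₁ w₂

/-! ### 1. Functoriality of `⨂_i A_i` in algebra (iso)morphisms -/

section PiTensorAlgebra

variable {R : Type u} [CommRing R] {ι : Type uι}
variable {A : ι → Type w₁} [∀ i, CommRing (A i)] [∀ i, Algebra R (A i)]
variable {B : ι → Type w₂} [∀ i, CommRing (B i)] [∀ i, Algebra R (B i)]

/-- Two algebra homomorphisms out of `⨂_i A_i` that agree on pure tensors are equal (multilinear extensionality; the
plumbing under [IUTchIII] Prop. 3.1 (i)'s "natural action of `^AΠ`" on `⊗_α log(^α𝓕_{v_ℚ})`).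
[cite: Mochizuki2012, Prop. 3.1 (i) p.93] [folklore] -/
theorem piTensor_algHom_ext {C : Type*} [Semiring C] [Algebra R C] {φ ψ : (⨂[R] i, A i) →ₐ[R] C}
    (h : ∀ x : ∀ i, A i, φ (PiTensorProduct.tprod R x) = ψ (PiTensorProduct.tprod R x)) : φ = ψ :=
  AlgHom.toLinearMap_injective (PiTensorProduct.ext (MultilinearMap.ext fun x => h x))

/-- The algebra homomorphism `⨂_i A_i → ⨂_i B_i` induced by algebra homomorphisms `f_i : A_i → B_i` ("tensor product
of the factorwise maps"; `⊗_i x_i ↦ ⊗_i f_i(x_i)`) — how `^AΠ = ∏_α ^αΠ` acts on `log(^A𝓕_{v_ℚ})` ([IUTchIII] Prop. 3.1 (i)).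
[cite: Mochizuki2012, Prop. 3.1 (i) p.93] [folklore] -/
def piTensorMapAlgHom (f : ∀ i, A i →ₐ[R] B i) : (⨂[R] i, A i) →ₐ[R] ⨂[R] i, B i :=
  PiTensorProduct.liftAlgHom ((PiTensorProduct.tprod R).compLinearMap fun i => (f i).toLinearMap)
    (by
      change PiTensorProduct.tprod R (fun i => f i ((1 : ∀ i, A i) i)) = 1
      rw [PiTensorProduct.one_def]
      congr 1
      funext i
      simp)
    (fun x y => by
      change PiTensorProduct.tprod R (fun i => f i ((x * y) i)) =
        PiTensorProduct.tprod R (fun i => f i (x i)) * PiTensorProduct.tprod R (fun i => f i (y i))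
      rw [tprod_mul_tprod]
      congr 1
      funext i
      simp [Pi.mul_apply])

/-- `piTensorMapAlgHom f (⊗_i x_i) = ⊗_i f_i(x_i)`. [cite: Mochizuki2012, Prop. 3.1 (i) p.93] [folklore] -/
@[simp] theorem piTensorMapAlgHom_tprod (f : ∀ i, A i →ₐ[R] B i) (x : ∀ i, A i) :
    piTensorMapAlgHom f (PiTensorProduct.tprod R x) = PiTensorProduct.tprod R (fun i => f i (x i)) := by
  simp [piTensorMapAlgHom]

omit [∀ i, CommRing (B i)] [∀ i, Algebra R (B i)] in
/-- Identity factorwise maps induce the identity. [cite: Mochizuki2012, Prop. 3.1 (i) p.93] [folklore] -/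
theorem piTensorMapAlgHom_id : piTensorMapAlgHom (fun i => AlgHom.id R (A i)) = AlgHom.id R (⨂[R] i, A i) :=
  piTensor_algHom_ext fun x => by simp

/-- Functoriality in composition (so that a GROUP acts). [cite: Mochizuki2012, Prop. 3.1 (i) p.93] [folklore] -/
theorem piTensorMapAlgHom_comp {C : ι → Type*} [∀ i, CommRing (C i)] [∀ i, Algebra R (C i)]
    (g : ∀ i, B i →ₐ[R] C i) (f : ∀ i, A i →ₐ[R] B i) :
    piTensorMapAlgHom (fun i => (g i).comp (f i)) = (piTensorMapAlgHom g).comp (piTensorMapAlgHom f) :=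
  piTensor_algHom_ext fun x => by simp

/-- The algebra ISOMORPHISM `⨂_i A_i ≅ ⨂_i B_i` induced by algebra isomorphisms `e_i : A_i ≅ B_i`.
[cite: Mochizuki2012, Prop. 3.1 (i) p.93] [folklore] -/
def piTensorMapAlgEquiv (e : ∀ i, A i ≃ₐ[R] B i) : (⨂[R] i, A i) ≃ₐ[R] ⨂[R] i, B i :=
  AlgEquiv.ofAlgHom (piTensorMapAlgHom fun i => (e i : A i →ₐ[R] B i))
    (piTensorMapAlgHom fun i => ((e i).symm : B i →ₐ[R] A i))
    (piTensor_algHom_ext fun x => by simp)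
    (piTensor_algHom_ext fun x => by simp)

/-- `piTensorMapAlgEquiv e (⊗_i x_i) = ⊗_i e_i(x_i)`. [cite: Mochizuki2012, Prop. 3.1 (i) p.93] [folklore] -/
@[simp] theorem piTensorMapAlgEquiv_tprod (e : ∀ i, A i ≃ₐ[R] B i) (x : ∀ i, A i) :
    piTensorMapAlgEquiv e (PiTensorProduct.tprod R x) = PiTensorProduct.tprod R (fun i => e i (x i)) :=
  piTensorMapAlgHom_tprod (fun i => (e i : A i →ₐ[R] B i)) x

/-- **`∏_i Aut_{R-alg}(A_i) →* Aut_{R-alg}(⨂_i A_i)`**: a family of factorwise algebra automorphisms acts on the tensor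
product by the tensor product of the automorphisms — the shape of "the natural action of `^AΠ`" on a tensor packet
([IUTchIII] Prop. 3.1 (i) p. 93). [cite: Mochizuki2012, Prop. 3.1 (i) p.93] [claim: Mochizuki2012, status: disputed] -/
def piTensorAut : (∀ i, (A i ≃ₐ[R] A i)) →* ((⨂[R] i, A i) ≃ₐ[R] ⨂[R] i, A i) where
  toFun e := piTensorMapAlgEquiv e
  map_one' := by
    apply AlgEquiv.coe_toAlgHom_injective
    exact piTensor_algHom_ext fun x => by simp
  map_mul' e e' := by
    apply AlgEquiv.coe_toAlgHom_injective
    refine piTensor_algHom_ext fun x => ?_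
    change piTensorMapAlgEquiv (e * e') (PiTensorProduct.tprod R x) =
      piTensorMapAlgEquiv e (piTensorMapAlgEquiv e' (PiTensorProduct.tprod R x))
    simp [AlgEquiv.mul_apply]

/-- `piTensorAut e (⊗_i x_i) = ⊗_i e_i(x_i)`. [cite: Mochizuki2012, Prop. 3.1 (i) p.93] [claim: Mochizuki2012, status: disputed] -/
@[simp] theorem piTensorAut_tprod (e : ∀ i, (A i ≃ₐ[R] A i)) (x : ∀ i, A i) :
    piTensorAut e (PiTensorProduct.tprod R x) = PiTensorProduct.tprod R (fun i => e i (x i)) :=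
  piTensorMapAlgEquiv_tprod e x

end PiTensorAlgebra

/-! ### 2. The Galois action on the packets of Proposition 3.1 and the equivariance of `toPacketAt` -/

section Packets

variable (𝕜 : Type u) [Field 𝕜]
variable {A : Type v} {Vfib : Type v'}
variable (L : A → Vfib → Type w) [∀ α v, CommRing (L α v)] [∀ α v, Algebra 𝕜 (L α v)]

/-- **The natural action of `^AΠ_{v_ℚ} = ∏_{α∈A} ^αΠ_{v_ℚ}` on the `n`-tensor packet `log(^A𝓕_{v_ℚ}) = ⊗_{α∈A} log(^α𝓕_{v_ℚ})`**
([IUTchIII] Prop. 3.1 (i) p. 93; the tensor product is over `𝕜 = ℚ_{v_ℚ}`): each `^αΠ_{v_ℚ}` acts on its own factor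
`log(^α𝓕_{v_ℚ}) = ⊕_v log(^α𝓕_v)` (abc-iut-L6-t4's `Packet1 L α`) by `𝕜`-algebra automorphisms, and the product group
acts by the tensor product of these (`piTensorAut`). [cite: Mochizuki2012, Prop. 3.1 (i) p.93]
[claim: Mochizuki2012, status: disputed] -/
def packetNAut : (∀ α, (Packet1 L α ≃ₐ[𝕜] Packet1 L α)) →* (PacketN 𝕜 L ≃ₐ[𝕜] PacketN 𝕜 L) :=
  piTensorAut

/-- `packetNAut σ (⊗_α x_α) = ⊗_α σ_α(x_α)`. [cite: Mochizuki2012, Prop. 3.1 (i) p.93] [claim: Mochizuki2012, status: disputed] -/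
@[simp] theorem packetNAut_tprod (σ : ∀ α, (Packet1 L α ≃ₐ[𝕜] Packet1 L α)) (x : ∀ α, Packet1 L α) :
    packetNAut 𝕜 L σ (PiTensorProduct.tprod 𝕜 x) = PiTensorProduct.tprod 𝕜 (fun α => σ α (x α)) :=
  piTensorAut_tprod σ x

/-- **The natural action on `log(^{A,α}𝓕_v) = log(^α𝓕_v) ⊗ (⊗_{β≠α} log(^β𝓕_{v_ℚ}))`** ([IUTchIII] Prop. 3.1 (ii) p. 93,
Prop. 3.4 (i) p. 102 "its `^αΠ_v`-action"): a pair (automorphism of the factor `log(^α𝓕_v) = L α v`, family of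
automorphisms of the other 1-packets) acts by "the action on `log(^α𝓕_v)` ⊗ the actions on the other factors"
(`Algebra.TensorProduct.congr`, the second through `piTensorAut`) — sub-DAG row Prop-34 r5.
[cite: Mochizuki2012, Prop. 3.1 (ii) p.93] [claim: Mochizuki2012, status: disputed] -/
def packetAtAut (α : A) (v : Vfib) :
    (L α v ≃ₐ[𝕜] L α v) × (∀ β : {β : A // β ≠ α}, (Packet1 L β.1 ≃ₐ[𝕜] Packet1 L β.1)) →*
      (PacketAt 𝕜 L α v ≃ₐ[𝕜] PacketAt 𝕜 L α v) where
  toFun στ := Algebra.TensorProduct.congr στ.1 (piTensorAut στ.2)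
  map_one' := by
    change Algebra.TensorProduct.congr (1 : L α v ≃ₐ[𝕜] L α v) (piTensorAut 1) = 1
    rw [map_one]
    exact Algebra.TensorProduct.congr_refl
  map_mul' στ στ' := by
    change Algebra.TensorProduct.congr (στ.1 * στ'.1) (piTensorAut (στ.2 * στ'.2)) =
      Algebra.TensorProduct.congr στ.1 (piTensorAut στ.2) * Algebra.TensorProduct.congr στ'.1 (piTensorAut στ'.2)
    rw [map_mul]
    exact Algebra.TensorProduct.congr_trans στ'.1 στ.1 (piTensorAut στ'.2) (piTensorAut στ.2)

/-- On pure tensors: `packetAtAut (σ, τ) (x ⊗ (⊗_β y_β)) = σ(x) ⊗ (⊗_β τ_β(y_β))`.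
[cite: Mochizuki2012, Prop. 3.1 (ii) p.93] [claim: Mochizuki2012, status: disputed] -/
@[simp] theorem packetAtAut_tmul_tprod (α : A) (v : Vfib) (σ : L α v ≃ₐ[𝕜] L α v)
    (τ : ∀ β : {β : A // β ≠ α}, (Packet1 L β.1 ≃ₐ[𝕜] Packet1 L β.1)) (x : L α v)
    (y : ∀ β : {β : A // β ≠ α}, Packet1 L β.1) :
    packetAtAut 𝕜 L α v (σ, τ) (x ⊗ₜ[𝕜] PiTensorProduct.tprod 𝕜 y) = σ x ⊗ₜ[𝕜] PiTensorProduct.tprod 𝕜 (fun β => τ β (y β)) := by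
  change Algebra.TensorProduct.congr σ (piTensorAut τ) (x ⊗ₜ[𝕜] PiTensorProduct.tprod 𝕜 y) = _
  rw [Algebra.TensorProduct.congr_apply, Algebra.TensorProduct.map_tmul]
  simp

/-- **[IUTchIII] Prop. 3.1 (ii) p. 93: `log(^α𝓕_v) → log(^{A,α}𝓕_v)` is "compatible with the natural actions of `^αΠ_v`"** —
abc-iut-L6-t4's `toPacketAt` ("tensor with `1`'s") is EQUIVARIANT for the action of `σ ∈ Aut(log(^α𝓕_v))` on the source
and of `(σ, τ)` on the packet, for EVERY `τ` on the other factors. PROVED. [cite: Mochizuki2012, Prop. 3.1 (ii) p.93]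
[claim: Mochizuki2012, status: disputed] -/
theorem packetAtAut_toPacketAt (α : A) (v : Vfib) (σ : L α v ≃ₐ[𝕜] L α v)
    (τ : ∀ β : {β : A // β ≠ α}, (Packet1 L β.1 ≃ₐ[𝕜] Packet1 L β.1)) (x : L α v) :
    packetAtAut 𝕜 L α v (σ, τ) (toPacketAt 𝕜 L α v x) = toPacketAt 𝕜 L α v (σ x) := by
  change Algebra.TensorProduct.congr σ (piTensorAut τ) (x ⊗ₜ[𝕜] 1) = σ x ⊗ₜ[𝕜] 1
  rw [Algebra.TensorProduct.congr_apply, Algebra.TensorProduct.map_tmul, map_one]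
  rfl

end Packets

/-! ### 3. Galois invariants (Proposition 3.4 (i)/(ii)) -/

section Invariants

variable (𝕜 : Type u) [Field 𝕜] {X : Type w} [Semiring X] [Algebra 𝕜 X]

/-- The subalgebra of elements fixed by a set `S` of `𝕜`-algebra automorphisms ("the submonoid/submodule of Galois
invariants", [IUTchIII] Prop. 3.4 (ii) p. 103 l. 6, l. 15). [cite: Mochizuki2012, Prop. 3.4 (ii) p.103]
[claim: Mochizuki2012, status: disputed] -/
def fixedSubalgebra (S : Set (X ≃ₐ[𝕜] X)) : Subalgebra 𝕜 X where
  carrier := {x | ∀ σ ∈ S, σ x = x}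
  mul_mem' hx hy σ hσ := by rw [map_mul, hx σ hσ, hy σ hσ]
  one_mem' σ _ := map_one σ
  add_mem' hx hy σ hσ := by rw [map_add, hx σ hσ, hy σ hσ]
  zero_mem' σ _ := map_zero σ
  algebraMap_mem' r σ _ := AlgEquiv.commutes σ r

/-- Membership in `fixedSubalgebra`. [cite: Mochizuki2012, Prop. 3.4 (ii) p.103] [claim: Mochizuki2012, status: disputed] -/
@[simp] theorem mem_fixedSubalgebra (S : Set (X ≃ₐ[𝕜] X)) (x : X) :
    x ∈ fixedSubalgebra 𝕜 S ↔ ∀ σ ∈ S, σ x = x := Iff.rfl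

/-- "this Galois action is trivial when `v ∈ 𝕍^arc`" (p. 103 l. 15–16): for the empty (or trivial) set of automorphisms
every element is invariant. [cite: Mochizuki2012, Prop. 3.4 (ii) p.103] [claim: Mochizuki2012, status: disputed] -/
theorem fixedSubalgebra_empty : fixedSubalgebra 𝕜 (∅ : Set (X ≃ₐ[𝕜] X)) = ⊤ :=
  eq_top_iff.mpr fun _ _ _ h => absurd h (Set.notMem_empty _)

variable {A : Type v} {Vfib : Type v'}
variable (L : A → Vfib → Type w) [∀ α v, CommRing (L α v)] [∀ α v, Algebra 𝕜 (L α v)]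

/-- `^αΠ_v` acting on `log(^{A,α}𝓕_v)` THROUGH THE `α`-FACTOR: the automorphisms `packetAtAut (σ, 1)` for `σ` in a set
`S ⊆ Aut(log(^α𝓕_v))` (the other factors carry their own groups `^βΠ`, Prop. 3.1 (i)).
[cite: Mochizuki2012, Prop. 3.4 (i) p.102] [claim: Mochizuki2012, status: disputed] -/
def alphaFactorAuts (α : A) (v : Vfib) (S : Set (L α v ≃ₐ[𝕜] L α v)) :
    Set (PacketAt 𝕜 L α v ≃ₐ[𝕜] PacketAt 𝕜 L α v) :=
  (fun σ => packetAtAut 𝕜 L α v (σ, 1)) '' S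

/-- The image of an invariant is invariant: `ι(Ψ ∩ log(^α𝓕_v)^S) ⊆ ι(Ψ) ∩ log(^{A,α}𝓕_v)^S` for `ι = toPacketAt`
(equivariance, `packetAtAut_toPacketAt`). [cite: Mochizuki2012, Prop. 3.4 (i) p.102] [claim: Mochizuki2012, status: disputed] -/
theorem singlePacketMonoid_map_fixed_le (α : A) (v : Vfib) (S : Set (L α v ≃ₐ[𝕜] L α v))
    (Ψ : Submonoid (L α v)) :
    singlePacketMonoid (𝕜 := 𝕜) (Lv := L α v) (Pv := PacketAt 𝕜 L α v) (toPacketAt 𝕜 L α v)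
        (Ψ ⊓ (fixedSubalgebra 𝕜 S).toSubmonoid) ≤
      singlePacketMonoid (𝕜 := 𝕜) (Lv := L α v) (Pv := PacketAt 𝕜 L α v) (toPacketAt 𝕜 L α v) Ψ ⊓
        (fixedSubalgebra 𝕜 (alphaFactorAuts 𝕜 L α v S)).toSubmonoid := by
  rintro _ ⟨x, ⟨hxΨ, hxS⟩, rfl⟩
  refine ⟨⟨x, hxΨ, rfl⟩, ?_⟩
  rintro _ ⟨σ, hσ, rfl⟩
  change packetAtAut 𝕜 L α v (σ, 1) (toPacketAt 𝕜 L α v x) = toPacketAt 𝕜 L α v x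
  rw [packetAtAut_toPacketAt, hxS σ hσ]

/-- **[IUTchIII] Prop. 3.4 (i)/(ii) "the submonoid of Galois invariants [cf. (i)]" COMPUTED**: for `^αΠ_v` acting on
`log(^{A,α}𝓕_v)` through the `α`-factor, the invariants of the single packet monoid `ι(Ψ)` (abc-iut-L6-t4's
`singlePacketMonoid`, `ι = toPacketAt` injective — Prop. 3.1 (ii), nontrivial complementary factor) ARE the image of the
invariants of `Ψ`: `ι(Ψ) ∩ log(^{A,α}𝓕_v)^{^αΠ_v} = ι(Ψ^{^αΠ_v})`. PROVED (equivariance + injectivity). This is the junction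
with `galFixed` of `GlobalPacketsLGPMonoidsOfGaussian.lean` (invariants taken at the source and pushed forward).
[cite: Mochizuki2012, Prop. 3.4 (ii) p.103] [claim: Mochizuki2012, status: disputed] -/
theorem singlePacketMonoid_inf_fixed_eq (α : A) (v : Vfib) (S : Set (L α v ≃ₐ[𝕜] L α v))
    (Ψ : Submonoid (L α v)) [Nontrivial (⨂[𝕜] β : {β : A // β ≠ α}, Packet1 L β.1)] :
    singlePacketMonoid (𝕜 := 𝕜) (Lv := L α v) (Pv := PacketAt 𝕜 L α v) (toPacketAt 𝕜 L α v) Ψ ⊓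
        (fixedSubalgebra 𝕜 (alphaFactorAuts 𝕜 L α v S)).toSubmonoid =
      singlePacketMonoid (𝕜 := 𝕜) (Lv := L α v) (Pv := PacketAt 𝕜 L α v) (toPacketAt 𝕜 L α v)
        (Ψ ⊓ (fixedSubalgebra 𝕜 S).toSubmonoid) := by
  refine le_antisymm ?_ (singlePacketMonoid_map_fixed_le 𝕜 L α v S Ψ)
  rintro _ ⟨⟨x, hxΨ, rfl⟩, hfix⟩
  refine ⟨x, ⟨hxΨ, fun σ hσ => ?_⟩, rfl⟩
  have h := hfix _ ⟨σ, hσ, rfl⟩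
  change packetAtAut 𝕜 L α v (σ, 1) (toPacketAt 𝕜 L α v x) = toPacketAt 𝕜 L α v x at h
  rw [packetAtAut_toPacketAt] at h
  exact toPacketAt_injective 𝕜 L α v h

end Invariants

end Literature.IUT.LogThetaLattice

end
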